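import Literature.Computability.QuantumComplexity.HadamardGadgetMachine
import Literature.Computability.QuantumComplexity.HadamardGadgetHopFamily
import Literature.Computability.Complexity.StringEquality
import HarnessLib

/-!
# Uniformity of the Hadamard-gadget family, VII: the machine prints the compiled circuit

Topic `Literature/Computability/QuantumComplexity`; last file of the uniformity half of the
discharge of `PostBQPWith_subset_PostIQPWith` (Bremner–Jozsa–Shepherd 2011, Thm. 1 with Def. 1 and
Def. 3). The functional model `HGadget.Hop.Asm.progM` of the machine (`HadamardGadgetMachine.lean`)
is identified, on the lexer's stream of `⟨z, F.descFn z⟩` (`HGadget.Lex.stream`,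
`HadamardGadgetLexer.lean`), with the description of the compiled post-selected IQP family
`HGadget.Hop.gadgetFamily F` (`HadamardGadgetHopFamily.lean`):

* reading the prefix: `n`, `bin n`, `m` and the gate tokens (`readOf_stream`);
* numerals: the fixed-width counter `numF L a` is the `L`-bit numeral of `a`, and
  `bin (a + 2^L c) = numF L a ++ bin c` (`encodeNat_posNat`), so that the printed texts of the
  machine are the doubled codes of the compiler's gates (`gtext_czN`, `gtext_hopN`, `gtext_blockN`,
  `gtext_initN`, `gtext_finalN`);
* the gate loop on the tokens of an oracle-free gate list processes it block by block
  (`loopM_wireTok`, `loopM_gateToks`, `loopM_gates`) printing `blocksN`;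
* whence **`progFn_stream`**: `progFn (stream F z) = (gadgetFamily F).descFn z`, and
  **`plFn_stream`** for the post-selection length; with `progFn_mem_FP`, the lexer's `FP`-ness and
  `fanoutFn`, **`gadgetFamily_isUniform`**, and finally the discharge
  **`PostBQPWith_subset_PostIQPWith_holds`**.

## References

* M. J. Bremner, R. Jozsa, D. J. Shepherd, Proc. R. Soc. A 467 (2011) 459–472, Def. 1, Def. 3, Thm. 1.
* S. Arora, B. Barak, *Computational Complexity: A Modern Approach*, CUP 2009, §1.3, §6.1, §6.2.
-/

noncomputable section

namespace Literature.Computability.QuantumComplexity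

open _root_.Computability Complexity Complexity.Com Cryptography Thm25Lex
open Thm25Asm (IsFlag isFlag_nil isFlag_true isFlag_flag)

namespace HGadget.Hop

namespace Asm

/-! ### Reading the stream -/

/-- **On the lexer's stream the machine reads `n`, `bin n`, `m` and the gate tokens.**
[cite: AroraBarak2009, §6.1 (descriptions of circuits)] -/
theorem readOf_stream (F : QCircuitFamily cliffordT) (z : List Bool) :
    nOf (Lex.stream F z) = z.length ∧ uOf (Lex.stream F z) = encodeNat z.length ∧ mOf (Lex.stream F z) = F.ancillas z.length ∧
      toksOf (Lex.stream F z) = (F.circ z.length).gates.flatMap Lex.gateToks := by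
  have h1 : pre1M (Lex.stream F z) = (z.length, Lex.annBits (encodeNat z.length) ++ false ::
      (List.replicate (F.ancillas z.length) true ++ false :: (F.circ z.length).gates.flatMap Lex.gateToks)) := pre1M_spec _ _
  have h2 := pre2M_spec (encodeNat z.length) (List.replicate (F.ancillas z.length) true ++ false :: (F.circ z.length).gates.flatMap Lex.gateToks)
  have h3 := pre1M_spec (F.ancillas z.length) ((F.circ z.length).gates.flatMap Lex.gateToks)
  refine ⟨by rw [nOf, h1], by rw [uOf, h1, h2], by rw [mOf, h1, h2, h3], by rw [toksOf, h1, h2, h3]⟩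

/-! ### Numerals -/

/-- Words of the same length with the same value are equal. [folklore] -/
theorem eq_of_bitsToNat_eq_of_length_eq : ∀ (v w : List Bool), v.length = w.length → bitsToNat v = bitsToNat w → v = w
  | [], [], _, _ => rfl
  | [], _ :: _, h, _ => absurd h (by simp)
  | _ :: _, [], h, _ => absurd h (by simp)
  | a :: v, b :: w, hl, hv => by
    simp only [List.length_cons, Nat.succ.injEq] at hl
    simp only [bitsToNat_cons] at hv
    have hab : a = b := by cases a <;> cases b <;> simp at hv ⊢ <;> omega
    subst hab
    rw [eq_of_bitsToNat_eq_of_length_eq v w hl (by omega)]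

/-- **The fixed-width counter holds the value it counted** (below `2^L`). [cite: KnuthTAOCP2, §4.3.1] -/
theorem bitsToNat_numF (L : ℕ) : ∀ a : ℕ, a < 2 ^ L → bitsToNat (numF L a) = a
  | 0, _ => by simp [numF]
  | a + 1, ha => by
    have ih := bitsToNat_numF L a (by omega)
    have hinc := TokConv.bitsToNat_incRes true (numF L a)
    rw [TokConv.incRes, ih, Bool.toNat_true] at hinc
    rw [numF_succ]
    cases hco : TokConv.co true (numF L a)
    · rw [hco, flag_false, List.append_nil] at hinc; exact hinc
    · exfalso
      rw [hco, flag_true, bitsToNat_append, length_ib, length_numF] at hinc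
      have : bitsToNat [true] = 1 := by decide
      rw [this] at hinc
      omega

/-- `|bin a| ≤ L` iff `a < 2^L`. [folklore] -/
theorem length_encodeNat_le_iff (a L : ℕ) : (encodeNat a).length ≤ L ↔ a < 2 ^ L := by
  rw [length_encodeNat_eq_size', Nat.size_le]

/-- The `L`-bit padding of a numeral. [folklore] -/
def padNum (L : ℕ) (u : List Bool) : List Bool := u ++ List.replicate (L - u.length) false

/-- **The counter is the padded numeral**: `numF L a = bin a ++ 0^{L - |bin a|}` for `a < 2^L`.
[cite: KnuthTAOCP2, §4.3.1] -/
theorem numF_eq_padNum {L a : ℕ} (ha : a < 2 ^ L) : numF L a = padNum L (encodeNat a) := by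
  have hl : (encodeNat a).length ≤ L := (length_encodeNat_le_iff a L).2 ha
  refine eq_of_bitsToNat_eq_of_length_eq _ _ ?_ ?_
  · rw [length_numF, padNum, List.length_append, List.length_replicate]; omega
  · rw [bitsToNat_numF L a ha, padNum, bitsToNat_append, bitsToNat_encodeNat, bitsToNat_replicate_false]; ring

/-- **The numeral of a stage wire**: `bin (a + 2^L c) = numF L a ++ bin c` for `a < 2^L`, `c ≥ 1`.
[cite: KnuthTAOCP2, §4.3.1 (positional notation)] -/
theorem encodeNat_posNat {L a c : ℕ} (ha : a < 2 ^ L) (hc : 1 ≤ c) : encodeNat (a + 2 ^ L * c) = numF L a ++ encodeNat c := by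
  have hcan : ∀ n, 1 ≤ n → ∃ v, encodeNat n = v ++ [true] := by
    intro n hn
    rcases encodeNat_canonical n with h | h
    · exfalso; have := congrArg bitsToNat h; rw [bitsToNat_encodeNat] at this; simp at this; omega
    · exact h
  refine eq_of_bitsToNat_eq_of_canonical _ _ (Or.inr (hcan _ (by have := Nat.one_le_two_pow (n := L); nlinarith))) ?_ ?_
  · obtain ⟨v, hv⟩ := hcan c hc
    exact Or.inr ⟨numF L a ++ v, by rw [hv, List.append_assoc]⟩
  · rw [bitsToNat_encodeNat, bitsToNat_append, bitsToNat_numF L a ha, length_numF, bitsToNat_encodeNat]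

/-! ### The gate loop on tokens -/

variable {L N : ℕ}

/-- The gate loop ignores the initial content of the stream register. [folklore] -/
theorem loopM_g_irrel : ∀ (z : List Bool) (s : St) (x : List Bool), loopM L N z { s with g := x } = loopM L N z s
  | [], _, _ => rfl
  | [_], _, _ => rfl
  | [_, _], _, _ => rfl
  | _ :: _ :: _ :: _, _, _ => rfl

/-- The handlers commute with setting the stream register. [folklore] -/
theorem actM_with_g (a b d : Bool) (s : St) (x : List Bool) : actM L N a b d { s with g := x } = { actM L N a b d s with g := x } := by
  cases a <;> cases b <;> cases d <;> first | rfl | (simp only [actM, hSEPM, commitM, padM]; split_ifs <;> rfl)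

/-- **One token**: the loop on `a b d z` handles the token and continues on `z`. [folklore] -/
theorem loopM_tok3 (a b d : Bool) (z : List Bool) (s : St) : loopM L N (a :: b :: d :: z) s = loopM L N z (actM L N a b d s) := by
  rw [loopM_cons₃, actM_with_g, loopM_g_irrel]

/-- A numeral-bit token pushes its bit and counts one tick off. [folklore] -/
theorem loopM_tokB (b : Bool) (z : List Bool) (s : St) : loopM L N (tokB b ++ z) s = loopM L N z { s with wa := b :: s.wa, lc := s.lc.tail } := by
  rw [show tokB b ++ z = false :: false :: b :: z from rfl, loopM_tok3]; rfl

/-- The bits of a numeral are accumulated (reversed) and counted off. [folklore] -/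
theorem loopM_bitsTok : ∀ (u : List Bool) (z : List Bool) (s : St),
    loopM L N (bitsTok u ++ z) s = loopM L N z { s with wa := u.reverse ++ s.wa, lc := s.lc.drop u.length }
  | [], z, s => rfl
  | b :: u, z, s => by
    rw [bitsTok_cons, List.append_assoc, loopM_tokB, loopM_bitsTok u]
    simp [List.drop_tail]

/-- The separator pads, commits and refills. [folklore] -/
theorem loopM_tokSEP (z : List Bool) (s : St) : loopM L N (Lex.tokSEP ++ z) s = loopM L N z (hSEPM L s) := by
  rw [show Lex.tokSEP ++ z = false :: true :: false :: z from rfl, loopM_tok3]; rfl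

/-- **A wire block loads the padded numeral of the wire into the next free slot** (countdown full,
accumulator empty; numerals longer than `L` are not padded). [cite: AroraBarak2009, §6.1] -/
theorem loopM_wireTok (w : ℕ) (z : List Bool) (s : St) (hlc : s.lc = List.replicate L true) (hwa : s.wa = []) :
    loopM L N (wireTok w ++ z) s =
      loopM L N z (if s.f1 = [] then { s with w1 := padNum L (encodeNat w) ++ s.w1, f1 := [true] } else { s with w2 := padNum L (encodeNat w) ++ s.w2 }) := by
  rw [wireTok, show tokWEND = Lex.tokSEP from rfl, List.append_assoc, loopM_bitsTok, loopM_tokSEP]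
  congr 1
  have hpad : (List.drop (encodeNat w).length s.lc).length = L - (encodeNat w).length := by rw [hlc, List.length_drop, List.length_replicate]
  simp only [hSEPM, commitM, padM, hpad, hwa, List.append_nil, List.reverse_append, List.reverse_replicate, List.reverse_reverse, padNum]
  split_ifs with h
  · cases s; simp only at hlc hwa h ⊢; subst hwa; subst h; subst hlc; rfl
  · cases s; simp only at hlc hwa h ⊢; subst hwa; subst hlc; rfl

end Asm

/-! ### The doubled codes of the compiler's gates -/

section Text

open Asm

variable {W : ℕ}

/-- **The doubled code of a gate list inside the circuit code**: each gate code doubled and ended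
by the pair separator `0 1` (the `boolPair` fold of `QCircuit.encode`). [cite: AroraBarak2009, §6.1] -/
def gtext (gs : List (QGate iqpDiag W)) : List Bool := gs.flatMap fun g => rep 2 g.encode ++ [false, true]

/-- `gtext` of nil. [folklore] -/
@[simp] theorem gtext_nil : gtext ([] : List (QGate iqpDiag W)) = [] := rfl
/-- `gtext` of cons. [folklore] -/
theorem gtext_cons (g : QGate iqpDiag W) (gs : List (QGate iqpDiag W)) : gtext (g :: gs) = (rep 2 g.encode ++ [false, true]) ++ gtext gs := rfl
/-- `gtext` of a concatenation. [folklore] -/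
@[simp] theorem gtext_append (gs gs' : List (QGate iqpDiag W)) : gtext (gs ++ gs') = gtext gs ++ gtext gs' := List.flatMap_append
/-- `gtext` of a `flatMap`. [folklore] -/
theorem gtext_flatMap {ι : Type*} (l : List ι) (f : ι → List (QGate iqpDiag W)) : gtext (l.flatMap f) = l.flatMap fun i => gtext (f i) := by
  induction l with
  | nil => rfl
  | cons a l ih => rw [List.flatMap_cons, gtext_append, ih, List.flatMap_cons]

/-- **The circuit code is the `gtext` of its gate list.** [cite: AroraBarak2009, §6.1] -/
theorem encode_eq_gtext (C : QCircuit iqpDiag W) : C.encode = gtext C.gates := by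
  obtain ⟨gs⟩ := C
  show gs.foldr (fun g acc => boolPair g.encode acc) [] = gtext gs
  induction gs with
  | nil => rfl
  | cons g gs ih => rw [List.foldr_cons, ih, gtext_cons, boolPair_eq_rep]

/-- The doubled code of the `CZ` emitter on in-range distinct wires. [cite: AroraBarak2009, §6.1] -/
theorem gtext_czN {p q : ℕ} (hp : p < W) (hq : q < W) (hpq : p ≠ q) : gtext (czN p q : List (QGate iqpDiag W)) = czText (encodeNat p) (encodeNat q) := by
  rw [czN, realizeOp, dif_pos ⟨hp, hq, hpq⟩, gtext_cons, gtext_nil, List.append_nil]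
  show rep 2 (false :: boolPair (encodeNat (Encodable.encode (IQPOp.CZ : iqpDiag.Op)))
    (encodingListNatBool.encode (List.ofFn fun i : Fin 2 => ((pairEmb (⟨p, hp⟩ : Fin W) ⟨q, hq⟩ (fun e => hpq (congrArg Fin.val e))) i : ℕ)))) ++
    [false, true] = _
  have h1 : encodeNat (Encodable.encode (IQPOp.CZ : iqpDiag.Op)) = [true] := rfl
  have h2 : (List.ofFn fun i : Fin 2 => ((pairEmb (⟨p, hp⟩ : Fin W) ⟨q, hq⟩ (fun e => hpq (congrArg Fin.val e))) i : ℕ)) = [p, q] := by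
    simp [List.ofFn_succ]
  rw [rep_cons, rep_two_boolPair, rep_two_encode_wires, h1, h2]
  simp [czText, preCZ, midSep, postSep, Thm25Lex.unaryEncodeNat_eq_replicate, rep, List.replicate]

/-- The doubled code of the `T` emitter on an in-range wire. [cite: AroraBarak2009, §6.1] -/
theorem gtext_tN {p : ℕ} (hp : p < W) : gtext (tN p : List (QGate iqpDiag W)) = tText (encodeNat p) := by
  rw [tN, realizeOp, dif_pos hp, gtext_cons, gtext_nil, List.append_nil]
  show rep 2 (false :: boolPair (encodeNat (Encodable.encode (IQPOp.T : iqpDiag.Op)))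
    (encodingListNatBool.encode (List.ofFn fun i : Fin 1 => ((wireEmb (⟨p, hp⟩ : Fin W)) i : ℕ)))) ++ [false, true] = _
  have h1 : encodeNat (Encodable.encode (IQPOp.T : iqpDiag.Op)) = [false, true] := rfl
  have h2 : (List.ofFn fun i : Fin 1 => ((wireEmb (⟨p, hp⟩ : Fin W)) i : ℕ)) = [p] := by simp [List.ofFn_succ]
  rw [rep_cons, rep_two_boolPair, rep_two_encode_wires, h1, h2]
  simp [tText, preT, postSep, Thm25Lex.unaryEncodeNat_eq_replicate, rep, List.replicate]

/-- The doubled code of the `Z` emitter on an in-range wire. [cite: AroraBarak2009, §6.1] -/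
theorem gtext_zN {p : ℕ} (hp : p < W) : gtext (zN p : List (QGate iqpDiag W)) = zText (encodeNat p) := by
  rw [zN, realizeOp, dif_pos hp, gtext_cons, gtext_nil, List.append_nil]
  show rep 2 (false :: boolPair (encodeNat (Encodable.encode (IQPOp.Z : iqpDiag.Op)))
    (encodingListNatBool.encode (List.ofFn fun i : Fin 1 => ((wireEmb (⟨p, hp⟩ : Fin W)) i : ℕ)))) ++ [false, true] = _
  have h1 : encodeNat (Encodable.encode (IQPOp.Z : iqpDiag.Op)) = [] := rfl
  have h2 : (List.ofFn fun i : Fin 1 => ((wireEmb (⟨p, hp⟩ : Fin W)) i : ℕ)) = [p] := by simp [List.ofFn_succ]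
  rw [rep_cons, rep_two_boolPair, rep_two_encode_wires, h1, h2]
  simp [zText, preZ, postSep, Thm25Lex.unaryEncodeNat_eq_replicate, rep, List.replicate]

end Text

/-! ### The texts of the compiler's layers -/

section Layers

open Asm

variable {n m : ℕ} (C : QCircuit cliffordT (n + m))

/-- `L = bitLen N` is the length of `bin (N + 1)`. [folklore] -/
theorem bitLen_eq (N : ℕ) : bitLen N = (encodeNat (N + 1)).length := by rw [bitLen, length_encodeNat_eq_size']

/-- **The numeral of the wire of qubit `i` at stage `s ≥ 1`** is the counter value followed by the
stage numeral. [cite: KnuthTAOCP2, §4.3.1] -/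
theorem encodeNat_posNat' {N s i : ℕ} (hi : i < N) (hs : 1 ≤ s) : encodeNat (posNat N s i) = numF (bitLen N) i ++ encodeNat s := by
  rw [posNat, stride]
  exact encodeNat_posNat (by have := lt_stride' N; rw [stride] at this; omega) hs

/-- **The hop layer prints `hopText`.** [cite: BremnerJozsaShepherdPRSA2011, Thm. 1 (proof, Fig. 1)] -/
theorem gtext_hopN {s : ℕ} (hs1 : 1 ≤ s) (hs : s + 1 ≤ finalStage C + 1) :
    gtext (hopN (n + m) s : List (QGate iqpDiag (width C))) = hopText (bitLen (n + m)) (n + m) (encodeNat s) (encodeNat (s + 1)) := by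
  rw [hopN, gtext_flatMap, hopText]
  refine List.flatMap_congr fun i hi => ?_
  rw [List.mem_range] at hi
  rw [gtext_czN (posNat_lt_width C (by omega) hi) (posNat_lt_width C hs hi) (posNat_ne_of_lt hi (Nat.lt_succ_self s)),
    encodeNat_posNat' hi hs1, encodeNat_posNat' hi (by omega)]

/-- The `T` emitter on a stage wire prints `tText` of the counter and the stage. [cite: BremnerJozsaShepherdPRSA2011, Thm. 1 (proof)] -/
theorem gtext_tN_posNat {s a : ℕ} (ha : a < n + m) (hs1 : 1 ≤ s) (hs : s ≤ finalStage C + 1) :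
    gtext (tN (posNat (n + m) s a) : List (QGate iqpDiag (width C))) = tText (numF (bitLen (n + m)) a ++ encodeNat s) := by
  rw [gtext_tN (posNat_lt_width C hs ha), encodeNat_posNat' ha hs1]

/-- **The printed text of a micro-operation block** (what the kind handlers print with the padded
numerals of the qubits and the stage numerals). [cite: BremnerJozsaShepherdPRSA2011, Thm. 1 (proof)] -/
def opText (L N s : ℕ) : MicroOp N → List Bool
  | .T a => blockTText L N (numF L a) (encodeNat s) (encodeNat (s + 1)) (encodeNat (s + 2))
  | .S a => blockSText L N (numF L a) (encodeNat s) (encodeNat (s + 1)) (encodeNat (s + 2))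
  | .H a => blockHText L N (numF L a) (encodeNat s) (encodeNat (s + 1)) (encodeNat (s + 2))
  | .CZ a b _ => blockCZText L N (numF L a) (numF L b) (encodeNat s) (encodeNat (s + 1)) (encodeNat (s + 2))

/-- **The block of a micro-operation prints `opText`.** [cite: BremnerJozsaShepherdPRSA2011, Thm. 1 (proof)] -/
theorem gtext_blockN {s : ℕ} (hs1 : 1 ≤ s) (h2 : s + 2 ≤ finalStage C + 1) (op : MicroOp (n + m)) :
    gtext (blockN (n + m) s op : List (QGate iqpDiag (width C))) = opText (bitLen (n + m)) (n + m) s op := by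
  have hh0 := gtext_hopN C hs1 (by omega : s + 1 ≤ finalStage C + 1)
  have hh1 := gtext_hopN C (by omega : 1 ≤ s + 1) h2
  cases op with
  | T a =>
    rw [blockN, gtext_append, gtext_append, gtext_tN_posNat C a.2 hs1 (by omega), hh0, hh1]; rfl
  | S a =>
    rw [blockN, gtext_append, gtext_append, gtext_append, gtext_tN_posNat C a.2 hs1 (by omega), hh0, hh1]; rfl
  | H a =>
    rw [blockN, gtext_append, gtext_append, gtext_append, gtext_append, gtext_append, gtext_append, gtext_append,
      gtext_tN_posNat C a.2 hs1 (by omega), gtext_tN_posNat C a.2 (by omega : 1 ≤ s + 1) (by omega),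
      gtext_tN_posNat C a.2 (by omega : 1 ≤ s + 2) h2, hh0, hh1]
    rfl
  | CZ a b hab =>
    rw [blockN, gtext_append, gtext_append, gtext_czN (posNat_lt_width C (by omega) a.2) (posNat_lt_width C (by omega) b.2)
      (fun h => hab (Fin.ext (posNat_injective _ _ h))), encodeNat_posNat' a.2 hs1, encodeNat_posNat' b.2 hs1, hh0, hh1]
    rfl

/-- The printed texts of a list of micro-operations from stage `s` on. [cite: BremnerJozsaShepherdPRSA2011, Thm. 1 (proof)] -/
def opsText (L N : ℕ) : ℕ → List (MicroOp N) → List Bool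
  | _, [] => []
  | s, op :: ops => opText L N s op ++ opsText L N (s + 2) ops

/-- **The blocks print `opsText`.** [cite: BremnerJozsaShepherdPRSA2011, Thm. 1 (proof)] -/
theorem gtext_blocksN : ∀ (ops : List (MicroOp (n + m))) (s : ℕ), 1 ≤ s → s + 2 * ops.length ≤ finalStage C →
    gtext (blocksN (n + m) s ops : List (QGate iqpDiag (width C))) = opsText (bitLen (n + m)) (n + m) s ops
  | [], s, _, _ => rfl
  | op :: ops, s, hs1, hs => by
    simp only [List.length_cons] at hs
    rw [blocksN, gtext_append, gtext_blockN C hs1 (by omega) op, gtext_blocksN ops (s + 2) (by omega) (by omega), opsText]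

/-- **The initial layer prints the machine's initial texts.** [cite: BremnerJozsaShepherdPRSA2011, Thm. 1 (proof)] -/
theorem gtext_initN (h2 : 2 ≤ finalStage C + 1) :
    gtext (initN n m : List (QGate iqpDiag (width C))) =
      initAText (bitLen (n + m)) n (encodeNat 2) ++ hopTextFrom (bitLen (n + m)) n m (encodeNat 1) (encodeNat 2) := by
  rw [initN, gtext_append, gtext_flatMap, gtext_flatMap, initAText, hopTextFrom]
  congr 1
  · refine List.flatMap_congr fun i hi => ?_
    rw [List.mem_range] at hi
    have hiN : i < n + m := by omega
    have hne : i ≠ posNat (n + m) 2 i := by unfold posNat; have := stride_pos (n + m); omega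
    rw [gtext_czN (by have := n_succ_lt_width C; omega) (posNat_lt_width C h2 hiN) hne, encodeNat_posNat' hiN (by norm_num)]
  · refine List.flatMap_congr fun j hj => ?_
    rw [List.mem_range] at hj
    have hjN : n + j < n + m := by omega
    rw [gtext_czN (posNat_lt_width C (by omega) hjN) (posNat_lt_width C h2 hjN) (posNat_ne_of_lt (N := n + m) hjN (by norm_num)),
      encodeNat_posNat' hjN le_rfl, encodeNat_posNat' hjN (by norm_num)]

/-- **The final layer prints `finalText`.** [cite: BremnerJozsaShepherdPRSA2011, Thm. 1 (proof) and Def. 3] -/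
theorem gtext_finalN :
    gtext (finalN n m (finalStage C) : List (QGate iqpDiag (width C))) =
      finalText (bitLen (n + m)) (n + m) (encodeNat (finalStage C)) (encodeNat (finalStage C + 1)) (encodeNat n) (encodeNat (n + 1)) := by
  have hsf : 1 ≤ finalStage C := by unfold finalStage; omega
  rw [finalN, gtext_append, gtext_zN (n_succ_lt_width C), gtext_flatMap, finalText, finalCZs]
  congr 1
  refine List.flatMap_congr fun i hi => ?_
  rw [List.mem_range] at hi
  have hne : posNat (n + m) (finalStage C) i ≠ finalTgt n m (finalStage C) i := by
    unfold finalTgt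
    have h1 := n_succ_lt_stride (n := n) (m := m)
    have h2 : stride (n + m) * 1 ≤ stride (n + m) * finalStage C := Nat.mul_le_mul_left _ hsf
    have h3 := mul_le_posNat (n + m) (finalStage C) i
    split_ifs
    · omega
    · omega
    · exact posNat_ne_of_lt hi (Nat.lt_succ_self _)
  rw [gtext_czN (posNat_lt_width C (Nat.le_succ _) hi) (finalTgt_lt_width C hi) hne, encodeNat_posNat' hi hsf]
  congr 1
  unfold finalTgt
  split_ifs with h0 h1
  · rfl
  · rfl
  · exact encodeNat_posNat' hi (by omega)

/-- **The whole compiled circuit's code.** [cite: BremnerJozsaShepherdPRSA2011, Thm. 1 (proof)] -/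
theorem encode_gadgetCircuit :
    (gadgetCircuit C).encode =
      (initAText (bitLen (n + m)) n (encodeNat 2) ++ hopTextFrom (bitLen (n + m)) n m (encodeNat 1) (encodeNat 2)) ++
        opsText (bitLen (n + m)) (n + m) 2 (microList C) ++
        finalText (bitLen (n + m)) (n + m) (encodeNat (finalStage C)) (encodeNat (finalStage C + 1)) (encodeNat n) (encodeNat (n + 1)) := by
  rw [encode_eq_gtext, show (gadgetCircuit C).gates = gadgetGates C from rfl, gadgetGates, gtext_append, gtext_append,
    gtext_initN C (by unfold finalStage; omega), gtext_blocksN C (microList C) 2 (by norm_num) (by unfold finalStage; omega), gtext_finalN C]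

end Layers

/-! ### The gate loop on the token blocks of the gates -/

namespace Asm

variable {N : ℕ}

/-- Clean states of the gate loop at stage `c`: empty accumulator and slots, slot flag down,
countdown full, stage numerals `c, c+1, c+2`, counter at rest. [folklore] -/
structure GClean (L N c : ℕ) (s : St) : Prop where
  /-- accumulator -/
  hwa : s.wa = []
  /-- first slot -/
  hw1 : s.w1 = []
  /-- second slot -/
  hw2 : s.w2 = []
  /-- slot flag -/
  hf1 : s.f1 = []
  /-- countdown -/
  hlc : s.lc = List.replicate L true
  /-- stages -/
  hst : Stages c s
  /-- the counter rests at `N` -/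
  hiF : s.iF = numF L N
  /-- the hop countdown is empty -/
  hcU : s.cU = []

/-- **The effect of the token block of an oracle-free gate** on a clean state at stage `c`: the
texts of its micro-operations are printed, the stages advance by two per micro-operation.
[cite: BremnerJozsaShepherdPRSA2011, Thm. 1 (proof)] -/
def gstepM (L N c k : ℕ) (txt : List Bool) (s : St) : St :=
  { s with o := txt.reverse ++ s.o, iF := numF L N, cU := [], sfU := List.replicate (2 * k) true ++ s.sfU, sB := encodeNat (c + 2 * k), s1 := encodeNat (c + 2 * k + 1), s2 := encodeNat (c + 2 * k + 2) }

/-- The tokens of a one-wire gate. [folklore] -/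
theorem gateToks_one (op : CliffordTOp) (e : Fin 1 ↪ Fin N) (h : cliffordT.arity op = 1) (e' : Fin (cliffordT.arity op) ↪ Fin N)
    (he : HEq e' e) : Lex.gateToks (QGate.gate (G := cliffordT) op e') = wireTok (e 0) ++ Lex.kindTokOf op := by
  cases op <;> cases h <;> cases he <;> (show (List.ofFn fun i : Fin 1 => ((e i : Fin N) : ℕ)).flatMap wireTok ++ _ = _; simp [List.ofFn_succ])

/-- The tokens of a `CNOT`. [folklore] -/
theorem gateToks_CNOT (e : Fin (cliffordT.arity CliffordTOp.CNOT) ↪ Fin N) :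
    Lex.gateToks (QGate.gate (G := cliffordT) CliffordTOp.CNOT e) = wireTok (embC e 0) ++ (wireTok (embC e 1) ++ Lex.tokCNOT) := by
  show (List.ofFn fun i : Fin 2 => ((e i : Fin N) : ℕ)).flatMap wireTok ++ _ = _
  simp [List.ofFn_succ, Lex.kindTokOf]
  rfl

/-- A qubit index is within `L = bitLen N` bits. [folklore] -/
theorem fin_lt_two_pow_bitLen (a : Fin N) : (a : ℕ) < 2 ^ bitLen N := by
  have := lt_stride' N; rw [stride] at this; omega

/-- **The token block of an oracle-free gate, processed from a clean state, prints the texts of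
its micro-operations and leaves a clean state two stages further per micro-operation.**
[cite: BremnerJozsaShepherdPRSA2011, Thm. 1 (proof)] -/
theorem loopM_gateToks {c : ℕ} (g : QGate cliffordT N) (hg : g.IsOracleFree) (z : List Bool) (s : St) (hc : GClean (bitLen N) N c s) :
    loopM (bitLen N) N (Lex.gateToks g ++ z) s =
      loopM (bitLen N) N z (gstepM (bitLen N) N c (microOps g).length (opsText (bitLen N) N c (microOps g)) s) := by
  obtain ⟨hwa, hw1, hw2, hf1, hlc, ⟨hsB, hs1, hs2⟩, -, -⟩ := hc
  have hdc : decodeNat s.sB = c := by rw [hsB, decode_encodeNat]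
  cases g with
  | oracle k e => exact absurd hg (by simp [QGate.IsOracleFree])
  | gate op e =>
    cases op with
    | H =>
      rw [gateToks_one CliffordTOp.H (embH e) rfl e HEq.rfl, List.append_assoc, loopM_wireTok _ _ s hlc hwa, if_pos hf1,
        show Lex.kindTokOf CliffordTOp.H ++ z = true :: false :: false :: z from rfl, loopM_tok3]
      congr 1
      rw [← numF_eq_padNum (fin_lt_two_pow_bitLen (embH e 0))]
      cases s; simp only at hwa hw1 hw2 hf1 hlc hsB hs1 hs2 hdc ⊢
      subst hwa hw1 hw2 hf1 hlc hsB hs1 hs2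
      simp [actM, hHM, stepM, advM, cleanupM, gstepM, microOps, opsText, opText, decode_encodeNat]
    | S =>
      rw [gateToks_one CliffordTOp.S (embS e) rfl e HEq.rfl, List.append_assoc, loopM_wireTok _ _ s hlc hwa, if_pos hf1,
        show Lex.kindTokOf CliffordTOp.S ++ z = true :: false :: true :: z from rfl, loopM_tok3]
      congr 1
      rw [← numF_eq_padNum (fin_lt_two_pow_bitLen (embS e 0))]
      cases s; simp only at hwa hw1 hw2 hf1 hlc hsB hs1 hs2 hdc ⊢
      subst hwa hw1 hw2 hf1 hlc hsB hs1 hs2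
      simp [actM, hSM, stepM, advM, cleanupM, gstepM, microOps, opsText, opText, decode_encodeNat]
    | T =>
      rw [gateToks_one CliffordTOp.T (embT e) rfl e HEq.rfl, List.append_assoc, loopM_wireTok _ _ s hlc hwa, if_pos hf1,
        show Lex.kindTokOf CliffordTOp.T ++ z = true :: true :: false :: z from rfl, loopM_tok3]
      congr 1
      rw [← numF_eq_padNum (fin_lt_two_pow_bitLen (embT e 0))]
      cases s; simp only at hwa hw1 hw2 hf1 hlc hsB hs1 hs2 hdc ⊢
      subst hwa hw1 hw2 hf1 hlc hsB hs1 hs2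
      simp [actM, hTM, stepM, advM, cleanupM, gstepM, microOps, opsText, opText, decode_encodeNat]
    | CNOT =>
      rw [gateToks_CNOT, List.append_assoc, loopM_wireTok _ _ s hlc hwa, if_pos hf1, List.append_assoc,
        loopM_wireTok (s := { s with w1 := padNum (bitLen N) (encodeNat (embC e 0 : ℕ)) ++ s.w1, f1 := [true] }) _ _ hlc hwa, if_neg (by simp),
        show Lex.tokCNOT ++ z = true :: true :: true :: z from rfl, loopM_tok3]
      congr 1
      rw [← numF_eq_padNum (fin_lt_two_pow_bitLen (embC e 0)), ← numF_eq_padNum (fin_lt_two_pow_bitLen (embC e 1))]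
      cases s; simp only at hwa hw1 hw2 hf1 hlc hsB hs1 hs2 hdc ⊢
      subst hwa hw1 hw2 hf1 hlc hsB hs1 hs2
      simp [actM, hCNOTM, adv3M, cleanupM, gstepM, microOps, opsText, opText, cnotText, decode_encodeNat, List.reverse_append]

/-- The cleaned state is clean two stages further per micro-operation. [folklore] -/
theorem gclean_gstepM {L N c k : ℕ} {txt : List Bool} {s : St} (h : GClean L N c s) : GClean L N (c + 2 * k) (gstepM L N c k txt s) :=
  ⟨h.hwa, h.hw1, h.hw2, h.hf1, h.hlc, ⟨rfl, rfl, rfl⟩, rfl, rfl⟩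

/-- Composing two gate steps. [folklore] -/
theorem gstepM_gstepM (L N c k k' : ℕ) (t t' : List Bool) (s : St) :
    gstepM L N (c + 2 * k) k' t' (gstepM L N c k t s) = gstepM L N c (k + k') (t ++ t') s := by
  have e1 : List.replicate (2 * k') true ++ (List.replicate (2 * k) true ++ s.sfU) = List.replicate (2 * (k + k')) true ++ s.sfU := by
    rw [← List.append_assoc, List.replicate_append_replicate]; congr 2; ring
  simp only [gstepM, List.reverse_append, List.append_assoc, e1, Nat.mul_add, Nat.add_assoc]

/-- `opsText` of a concatenation. [folklore] -/
theorem opsText_append (L N : ℕ) : ∀ (ops ops' : List (MicroOp N)) (s : ℕ),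
    opsText L N s (ops ++ ops') = opsText L N s ops ++ opsText L N (s + 2 * ops.length) ops'
  | [], ops', s => by simp [opsText]
  | op :: ops, ops', s => by
    rw [List.cons_append, opsText, opsText_append L N ops ops' (s + 2), opsText, List.append_assoc, List.length_cons]
    congr 3; ring

/-- **A whole oracle-free gate list** is processed block by block. [cite: BremnerJozsaShepherdPRSA2011, Thm. 1 (proof)] -/
theorem loopM_gates : ∀ (gs : List (QGate cliffordT N)) (_ : ∀ g ∈ gs, g.IsOracleFree) (z : List Bool) (c : ℕ) (s : St), GClean (bitLen N) N c s →
    loopM (bitLen N) N (gs.flatMap Lex.gateToks ++ z) s =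
      loopM (bitLen N) N z (gstepM (bitLen N) N c (gs.flatMap microOps).length (opsText (bitLen N) N c (gs.flatMap microOps)) s)
  | [], _, z, c, s, hc => by
    rw [List.flatMap_nil, List.nil_append, List.flatMap_nil, List.length_nil, opsText]
    congr 1
    obtain ⟨-, -, -, -, -, ⟨sB, s1, s2⟩, hiF, hcU⟩ := hc
    cases s; simp only at sB s1 s2 hiF hcU; subst sB s1 s2 hiF hcU
    simp [gstepM]
  | g :: gs, hgs, z, c, s, hc => by
    rw [List.flatMap_cons, List.append_assoc, loopM_gateToks g (hgs g (by simp)) _ s hc,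
      loopM_gates gs (fun g' hg' => hgs g' (by simp [hg'])) z _ _ (gclean_gstepM hc), gstepM_gstepM, List.flatMap_cons, List.length_append,
      opsText_append]

/-! ### The machine on the lexer's stream -/

section Final

variable (F : QCircuitFamily cliffordT) (z : List Bool)

/-- `N = n + m` on the stream. [folklore] -/
theorem NOf_stream : NOf (Lex.stream F z) = z.length + F.ancillas z.length := by
  obtain ⟨h1, -, h3, -⟩ := readOf_stream F z
  rw [NOf, h1, h3]

/-- `L = bitLen N` on the stream. [folklore] -/
theorem LOf_stream : LOf (Lex.stream F z) = bitLen (z.length + F.ancillas z.length) := by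
  rw [LOf, NOf_stream, bitLen_eq]

/-- **The state entering the gate loop is clean at stage `2`.** [folklore] -/
theorem gclean_preLoop : GClean (bitLen (z.length + F.ancillas z.length)) (z.length + F.ancillas z.length) 2 (preLoop (Lex.stream F z)) := by
  refine ⟨rfl, rfl, rfl, rfl, ?_, ⟨rfl, rfl, rfl⟩, ?_, rfl⟩
  · show List.replicate (LOf (Lex.stream F z)) true = _; rw [LOf_stream]
  · show numF (LOf (Lex.stream F z)) (NOf (Lex.stream F z)) = _; rw [LOf_stream, NOf_stream]

/-- **The state after the gate loop on the stream.** [cite: BremnerJozsaShepherdPRSA2011, Thm. 1 (proof)] -/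
theorem postLoop_stream (hF : F.IsOracleFree) :
    postLoop (Lex.stream F z) =
      { gstepM (bitLen (z.length + F.ancillas z.length)) (z.length + F.ancillas z.length) 2 (microList (F.circ z.length)).length
          (opsText (bitLen (z.length + F.ancillas z.length)) (z.length + F.ancillas z.length) 2 (microList (F.circ z.length)))
          (preLoop (Lex.stream F z)) with g := [] } := by
  obtain ⟨-, -, -, h4⟩ := readOf_stream F z
  rw [postLoop, LOf_stream, NOf_stream, h4, ← List.append_nil ((F.circ z.length).gates.flatMap Lex.gateToks),
    loopM_gates _ (hF z.length) [] 2 _ (gclean_preLoop F z), loopM_nil]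
  rfl

/-- `finalStage = 2 + 2 |microList|`. [folklore] -/
theorem two_add_two_mul_microList {N : ℕ} (C : QCircuit cliffordT N) : 2 + 2 * (microList C).length = finalStage C := rfl

/-- **The printed text on the stream is the code of the compiled circuit** (reversed on the body
register). [cite: BremnerJozsaShepherdPRSA2011, Thm. 1 (proof) with Def. 1] -/
theorem postFinal_o_stream (hF : F.IsOracleFree) : (postFinal (Lex.stream F z)).o.reverse = (gadgetCircuit (F.circ z.length)).encode := by
  obtain ⟨h1, h2, h3, -⟩ := readOf_stream F z
  have hL := LOf_stream F z
  have hN := NOf_stream F z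
  rw [encode_gadgetCircuit]
  simp only [postFinal, postLoop_stream F z hF, gstepM, preLoop, List.reverse_append, List.reverse_reverse, List.append_assoc, hL, hN, h1, h2, h3,
    two_add_two_mul_microList, ← TokConv.encodeNat_succ_eq_incRes]

/-- The ticks of `sfU` on the stream: `s_f + 1`. [folklore] -/
theorem sfU_stream (hF : F.IsOracleFree) : (postLoop (Lex.stream F z)).sfU.length = finalStage (F.circ z.length) + 1 := by
  rw [postLoop_stream F z hF]
  simp only [gstepM, preLoop, List.length_append, List.length_replicate, List.length_cons, List.length_nil, ← two_add_two_mul_microList]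
  ring

/-- **The machine prints the description of the compiled family**: `progFn (stream F z) = descFn`.
[cite: BremnerJozsaShepherdPRSA2011, Thm. 1 (proof) with Def. 1; AroraBarak2009, §6.1] -/
theorem progFn_stream (hF : F.IsOracleFree) : progFn (Lex.stream F z) = (gadgetFamily F).toIQPFamily.toQCircuitFamily.descFn z := by
  obtain ⟨h1, h2, h3, -⟩ := readOf_stream F z
  rw [QCircuitFamily.descFn_eq, progFn, progM]
  show resOf (Lex.stream F z) = _
  rw [resOf, sfU_stream F z hF, postFinal_o_stream F z hF, LOf_stream, h2, h3, boolPair_eq_rep, boolPair_eq_rep,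
    Thm25Lex.unaryEncodeNat_eq_replicate, rep_replicate]
  show _ = rep 2 (encodeNat z.length) ++ [false, true] ++
    (List.replicate (ancillas z.length (F.ancillas z.length) (F.circ z.length) * 2) true ++ [false, true] ++ (gadgetCircuit (F.circ z.length)).encode)
  simp only [ancillas, stride, List.append_assoc, List.cons_append, List.nil_append]
  congr 3
  ring

/-- **The machine prints the post-selection length in unary**: `plFn (stream F z) = 1^{postLen}`.
[cite: BremnerJozsaShepherdPRSA2011, Def. 3] -/
theorem plFn_stream (hF : F.IsOracleFree) :
    plFn (Lex.stream F z) = unaryEncodeNat (postLen z.length (F.ancillas z.length) (F.circ z.length)) := by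
  obtain ⟨h1, -, -, -⟩ := readOf_stream F z
  rw [plFn, progM]
  show List.replicate (2 ^ LOf (Lex.stream F z) * (postLoop (Lex.stream F z)).sfU.length + 1 - nOf (Lex.stream F z)) true = _
  rw [sfU_stream F z hF, LOf_stream, h1, Thm25Lex.unaryEncodeNat_eq_replicate, postLen, stride]

end Final

end Asm

/-! ### Uniformity and the discharge -/

section Discharge

open Asm

/-- **The description function of the compiled family factors through the machine**: lexer after
pairing the input with the given family's description. [cite: AroraBarak2009, §6.2 (uniform families)] -/
theorem descFn_gadgetFamily_eq (F : QCircuitFamily cliffordT) (hF : F.IsOracleFree) :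
    (gadgetFamily F).toIQPFamily.toQCircuitFamily.descFn = progFn ∘ Lex.lexT.eval ∘ fanoutFn (fun w => w) F.descFn := by
  funext z
  rw [Function.comp_apply, Function.comp_apply, fanoutFn_apply, Lex.eval_input, progFn_stream F z hF]

/-- Transport of an `FP` function to unary numerals (same machine, same polynomial). [folklore] -/
theorem polyTime_unary_of_FP {g : List Bool → List Bool} (hg : g ∈ FP) {k : ℕ → ℕ} (hk : ∀ n, g (unaryEncodeNat n) = unaryEncodeNat (k n)) :
    PolyTimeComputable unaryEncodeNat unaryEncodeNat k := by
  obtain ⟨p, M, hM⟩ := hg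
  refine ⟨p, M, fun n => ?_⟩
  have h := hM (unaryEncodeNat n)
  simp only [id] at h
  rw [hk] at h
  exact h

/-- **The compiled post-selected IQP family of a uniform oracle-free Clifford+`T` family is uniform.**
[cite: BremnerJozsaShepherdPRSA2011, Thm. 1 (proof: "the description of the IQP circuit is computed
in polynomial time from that of the given circuit"); AroraBarak2009, §6.2] -/
theorem gadgetFamily_isUniform (F : QCircuitFamily cliffordT) (hF : F.IsOracleFree) (hU : F.IsUniform) : (gadgetFamily F).IsUniform := by
  have hpair : fanoutFn (fun w => w) F.descFn ∈ FP := fanoutFn_mem_FP (PolyTimeComputable.id _) (QCircuitFamily.descFn_mem_FP_of_isUniform hU)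
  refine ⟨QCircuitFamily.isUniform_of_descFn_mem_FP ?_, ?_⟩
  · rw [descFn_gadgetFamily_eq F hF]
    exact comp_mem_FP progFn_mem_FP (comp_mem_FP Lex.lexT_eval_mem_FP hpair)
  · refine polyTime_unary_of_FP (comp_mem_FP plFn_mem_FP (comp_mem_FP Lex.lexT_eval_mem_FP hpair)) fun n => ?_
    rw [Function.comp_apply, Function.comp_apply, fanoutFn_apply, Lex.eval_input, plFn_stream F _ hF]
    have hn : (unaryEncodeNat n).length = n := by rw [Thm25Lex.unaryEncodeNat_eq_replicate, List.length_replicate]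
    have key : ∀ m : ℕ, m = n → unaryEncodeNat (postLen m (F.ancillas m) (F.circ m)) = unaryEncodeNat (postLen n (F.ancillas n) (F.circ n)) := by
      rintro m rfl; rfl
    exact key _ hn

end Discharge

end HGadget.Hop

end Literature.Computability.QuantumComplexity
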